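import Summits.Ventures.HodgeRepro2.T5DualPairSwap

/-!
# T5TwistPartner — «a character twist changes neither the non-vanishing of Hom nor uniqueness»

Kernel witness (cell pub-hodge-repro2, seat p3, Tier-5 support for sub-steps N3 / N2 / N4.2) for
the one-line [A]s

* route/T5-N3-route-2.md §N3.10.2: «The unitary Weil representation with the (χ_V, χ_W)-splittings
  at a split place is ω_{3,2} up to a character twist of each GL-factor — the SPLIT DICTIONARY [A]
  … — and a character twist of π or π′ changes neither the non-vanishing of Hom nor uniqueness
  [A]»;
* route/T5-N2-route-3.md §N2.10.2: «replacing the U(V)-side character by ν_E·(itself) multiplies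
  the splitting by ν_E(x(g)) = ν(det g) … i.e. our ω_{χ_V, χ′_V, ψ_v} = GRS's ω_{γ,ψ_v} ⊗ (ν∘det ⊠ 1).
  Hence: σ̄_v occurs in our lift to H_d ⟺ π := σ̄_v ⊗ ν^{−1}∘det has a GRS Howe lift to H_d»;
* route/T5-route-3.md l. 25 (N4.2 row B2): «ω_{2,3} twisted by the splitting characters (a
  character twist that does not affect non-vanishing) [A: split dictionary, standard]».

What is kernel-checked here (the cell's own `twist` / `extTprod` of T5SplittingTwist and
`HasPartner` / `IsIso` / `AtMostOneRight` of T5DualPairSwap, nothing re-declared): for ANY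
representation `ω` of `G × H` and ANY character `ξ : G × H →* kˣ`,

* `isIntertwiningMap_twist_extTprod_iff`, `hasPartner_twist_iff`: a (non-zero) intertwining map
  `twist ω ξ → σ ⊠ π` is the same linear map as a (non-zero) intertwining map
  `ω → twist σ (ξ⁻¹∘inl) ⊠ twist π (ξ⁻¹∘inr)` — «ω ⊗ (ν∘det ⊠ 1) has the partner (σ, π) iff ω has
  the partner (σ ⊗ ν⁻¹∘det, π)»;
* `hasPartner_twist_twist_iff`: the same with the twist moved to the partners;
* `isIso_twist_iff`: twisting by a character preserves and reflects isomorphism;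
* `atMostOneRight_twist_iff`, `atMostOneLeft_twist_iff`: the uniqueness statements (D_σ) / (D_π)
  are unchanged by a character twist of `ω` (equivalently of the partners).

What stays prose (labels unchanged): that the cell's `ω_v` IS `ω_{3,2}` / GRS's `ω_{γ,ψ}` up to
the named twist (the dictionaries themselves).

README §8(d): this file uses an L-value-free non-vanishing device: NO.
-/

namespace Summit.Ventures.HodgeRepro2.T5TwistPartner

open Summit.Ventures.HodgeRepro2.T5SplittingTwist (extTprod twist twist_extTprod
  twist_extTprod_of_character isIntertwiningMap_twist_iff twist_inv_twist twist_twist_inv)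
open Summit.Ventures.HodgeRepro2.T5DualPairSwap (HasPartner IsIso AtMostOneRight AtMostOneLeft)
open TensorProduct Representation

universe u

variable {k G H V V₁ V₂ : Type*} [CommSemiring k] [Monoid G] [Monoid H]
  [AddCommMonoid V] [Module k V] [AddCommMonoid V₁] [Module k V₁] [AddCommMonoid V₂] [Module k V₂]

section Hom

/-- `f` intertwines `twist ω ξ → σ ⊠ π` iff `f` intertwines
`ω → twist σ (ξ⁻¹ ∘ inl) ⊠ twist π (ξ⁻¹ ∘ inr)`. -/
theorem isIntertwiningMap_twist_extTprod_iff (ω : Representation k (G × H) V)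
    (σ : Representation k G V₁) (π : Representation k H V₂) (ξ : G × H →* kˣ)
    (f : V →ₗ[k] V₁ ⊗[k] V₂) :
    (twist ω ξ).IsIntertwiningMap (extTprod σ π) f ↔
      ω.IsIntertwiningMap (extTprod (twist σ (ξ⁻¹.comp (MonoidHom.inl G H)))
        (twist π (ξ⁻¹.comp (MonoidHom.inr G H)))) f := by
  conv_lhs => rw [← twist_twist_inv (extTprod σ π) ξ]
  rw [isIntertwiningMap_twist_iff, twist_extTprod_of_character]

/-- Twisting `ω` by `ξ` moves the partners by `ξ⁻¹`: non-vanishing of `Hom` is unchanged. -/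
theorem hasPartner_twist_iff (ω : Representation k (G × H) V) (σ : Representation k G V₁)
    (π : Representation k H V₂) (ξ : G × H →* kˣ) :
    HasPartner (twist ω ξ) σ π ↔
      HasPartner ω (twist σ (ξ⁻¹.comp (MonoidHom.inl G H)))
        (twist π (ξ⁻¹.comp (MonoidHom.inr G H))) := by
  constructor
  · rintro ⟨f, hf0, hf⟩
    exact ⟨f, hf0, (isIntertwiningMap_twist_extTprod_iff ω σ π ξ f).mp hf⟩
  · rintro ⟨f, hf0, hf⟩
    exact ⟨f, hf0, (isIntertwiningMap_twist_extTprod_iff ω σ π ξ f).mpr hf⟩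

/-- The same statement with the twist on the partners: `(twist σ χ₁, twist π χ₂)` are partners
under `ω` iff `(σ, π)` are partners under `twist ω (χ₁ ⊠ χ₂)⁻¹`. -/
theorem hasPartner_twist_twist_iff (ω : Representation k (G × H) V) (σ : Representation k G V₁)
    (π : Representation k H V₂) (χ₁ : G →* kˣ) (χ₂ : H →* kˣ) :
    HasPartner ω (twist σ χ₁) (twist π χ₂) ↔ HasPartner (twist ω (χ₁.coprod χ₂)⁻¹) σ π := by
  have h := hasPartner_twist_iff ω σ π (χ₁.coprod χ₂)⁻¹
  have hi : ((χ₁.coprod χ₂)⁻¹)⁻¹ = χ₁.coprod χ₂ := inv_inv _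
  rw [hi, MonoidHom.coprod_comp_inl, MonoidHom.coprod_comp_inr] at h
  exact h.symm

end Hom

section Uniqueness

/-- Twisting by a character preserves and reflects isomorphism of representations. -/
theorem isIso_twist_iff {M : Type*} [Monoid M] {W W' : Type*} [AddCommMonoid W] [Module k W]
    [AddCommMonoid W'] [Module k W'] (ρ : Representation k M W) (ρ' : Representation k M W')
    (χ : M →* kˣ) : IsIso (twist ρ χ) (twist ρ' χ) ↔ IsIso ρ ρ' := by
  constructor
  · rintro ⟨e, he⟩
    exact ⟨e, (isIntertwiningMap_twist_iff ρ ρ' χ e.toLinearMap).mp he⟩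
  · rintro ⟨e, he⟩
    exact ⟨e, (isIntertwiningMap_twist_iff ρ ρ' χ e.toLinearMap).mpr he⟩

/-- (D_σ) is unchanged by a character twist of `ω`: the partners of `σ` under `twist ω ξ` are
unique up to isomorphism iff the partners of `twist σ (ξ⁻¹ ∘ inl)` under `ω` are. -/
theorem atMostOneRight_twist_iff (ω : Representation k (G × H) V) (σ : Representation k G V₁)
    (ξ : G × H →* kˣ) :
    AtMostOneRight.{u} (twist ω ξ) σ ↔
      AtMostOneRight.{u} ω (twist σ (ξ⁻¹.comp (MonoidHom.inl G H))) := by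
  constructor
  · intro h V₂ V₂' _ _ _ _ π π' h1 h2
    have h1' : HasPartner (twist ω ξ) σ (twist π (ξ⁻¹.comp (MonoidHom.inr G H))⁻¹) := by
      rw [hasPartner_twist_iff, twist_twist_inv]
      exact h1
    have h2' : HasPartner (twist ω ξ) σ (twist π' (ξ⁻¹.comp (MonoidHom.inr G H))⁻¹) := by
      rw [hasPartner_twist_iff, twist_twist_inv]
      exact h2
    have := h V₂ V₂' _ _ h1' h2'
    rw [← isIso_twist_iff _ _ (ξ⁻¹.comp (MonoidHom.inr G H)), twist_twist_inv, twist_twist_inv]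
      at this
    exact this
  · intro h V₂ V₂' _ _ _ _ π π' h1 h2
    rw [hasPartner_twist_iff] at h1 h2
    exact (isIso_twist_iff π π' _).mp (h V₂ V₂' _ _ h1 h2)

/-- (D_π) is unchanged by a character twist of `ω`. -/
theorem atMostOneLeft_twist_iff (ω : Representation k (G × H) V) (π : Representation k H V₂)
    (ξ : G × H →* kˣ) :
    AtMostOneLeft.{u} (twist ω ξ) π ↔
      AtMostOneLeft.{u} ω (twist π (ξ⁻¹.comp (MonoidHom.inr G H))) := by
  constructor
  · intro h V₁ V₁' _ _ _ _ σ σ' h1 h2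
    have h1' : HasPartner (twist ω ξ) (twist σ (ξ⁻¹.comp (MonoidHom.inl G H))⁻¹) π := by
      rw [hasPartner_twist_iff, twist_twist_inv]
      exact h1
    have h2' : HasPartner (twist ω ξ) (twist σ' (ξ⁻¹.comp (MonoidHom.inl G H))⁻¹) π := by
      rw [hasPartner_twist_iff, twist_twist_inv]
      exact h2
    have := h V₁ V₁' _ _ h1' h2'
    rw [← isIso_twist_iff _ _ (ξ⁻¹.comp (MonoidHom.inl G H)), twist_twist_inv, twist_twist_inv]
      at this
    exact this
  · intro h V₁ V₁' _ _ _ _ σ σ' h1 h2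
    rw [hasPartner_twist_iff] at h1 h2
    exact (isIso_twist_iff σ σ' _).mp (h V₁ V₁' _ _ h1 h2)

end Uniqueness

end Summit.Ventures.HodgeRepro2.T5TwistPartner
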